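import Mathlib
import Summits.CriticalPhenomena.PercolationContinuityZ3.Theorems.PinholeClosing.Negative.PinholeClosingBaseline
import HarnessLib

/-!
# Stub `stub_tightPocketExists` of line `pocket-resampling-liveness-mass` (crux `PercBudgetLadder.PinholeClosing`, stmt-CriticalPhenomena-5249)

Existence of a tight pocket: a lattice configuration in the budget-`(k+1)` blocked event of the window
`box 3 n → ∂ⁱⁿ box 3 m`, `n < m`, admits a `⊂`-minimal admissible vertex set with at most `k+1` open
boundary edges.

Registered signature (lead prover-line-stmt-CriticalPhenomena-5249-1, skeleton
`Cruxes/PinholeClosing/Lines/pocket_resampling_liveness_mass.lean` rev 1): proved VERBATIM below as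
`Summit.CriticalPhenomena.PercolationContinuityZ3.Theorems.stub_tightPocketExists`; helper lemmas live in
`namespace StubTightPocketExists`.  No new definitions (tree vocabulary only).

Proof.  Let `S`, `#S ≤ k+1`, block the window for `ω ∖ S`.  The source cluster
`A₀ = {v ∈ box 3 m | v` is joined inside `box 3 m` to `box 3 n` by an `ω ∖ S`-open path`}` contains
`box 3 n` (empty paths, `box 3 n ⊆ box 3 m`), misses `∂ⁱⁿ box 3 m` (no crossing), and each of its
`ω`-open boundary edges lies in `S` (otherwise the path extends across it; the outer endpoint lies in
`box 3 m` because the inner one is not on `∂ⁱⁿ box 3 m`), so it is admissible with `≤ k+1` open boundary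
edges (`StubTightPocketExists.exists_admissible_filter_subset`; the lattice hypothesis
`ω ⊆ (zdGraph 3).edgeSet` of the registered signature is not used).  A cardinality-minimal admissible set
with `≤ k+1` open boundary edges (`Finset.exists_min_image` over the powerset of `box 3 m`) is then
`⊂`-minimal (`Finset.card_lt_card`).
-/

noncomputable section

namespace Summit.CriticalPhenomena.PercolationContinuityZ3.Theorems

open MeasureTheory Finset
open Literature.Probability.Percolation Literature.Probability.LatticeModels
open Summit.CriticalPhenomena.PercolationContinuityZ3.Theorems.PinholeClosing.Negative
open scoped Classical

namespace StubTightPocketExists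

/-- One more open step inside the window: if `u` is joined to `x` inside `box 3 m` by an
`ω ∖ S`-open path and `s(u, v) ∈ ω ∖ S` with `v ∈ box 3 m`, `u ≠ v`, then so is `v`. -/
theorem openConnIn_step {m : ℕ} {ω : BondConfig (Site 3)} {S : Finset (Sym2 (Site 3))}
    {x u v : Site 3}
    (hu : (ω \ (↑S : Set (Sym2 (Site 3)))) ∈ openConnIn (↑(box 3 m) : Set (Site 3)) x u)
    (hv : v ∈ box 3 m) (he : s(u, v) ∈ ω) (heS : s(u, v) ∉ S) (hne : u ≠ v) :
    (ω \ (↑S : Set (Sym2 (Site 3)))) ∈ openConnIn (↑(box 3 m) : Set (Site 3)) x v := by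
  obtain ⟨hx, hu', hr⟩ := hu
  refine ⟨hx, Finset.mem_coe.2 hv, hr.trans (SimpleGraph.Adj.reachable ?_)⟩
  simp only [SimpleGraph.induce_adj, openGraph_adj, Set.mem_sdiff, Finset.mem_coe]
  exact ⟨⟨he, heS⟩, hne⟩

-- adapted from Cruxes/PinholeClosing/SketchIdeator5.lean (`stays_of_boundary_subset`, cut property)
/-- **The source cluster is an admissible cut witness.**  If closing `S` blocks the window
`box 3 n → ∂ⁱⁿ box 3 m` (`n < m`) for the configuration `ω`, then some admissible set
(containing `box 3 n`, inside `box 3 m ∖ ∂ⁱⁿ box 3 m`) has all its `ω`-open boundary edges in `S`: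
the set of vertices of `box 3 m` joined to `box 3 n` inside `box 3 m` by `ω ∖ S`-open paths.  (No
lattice hypothesis is needed: boundary edges are lattice edges by definition.) -/
theorem exists_admissible_filter_subset {n m : ℕ} (hnm : n < m) {ω : BondConfig (Site 3)}
    (S : Finset (Sym2 (Site 3)))
    (hblk : ¬ ∃ x ∈ box 3 n, ∃ y ∈ innerBoundary (zdGraph 3) (box 3 m),
      (ω \ (↑S : Set (Sym2 (Site 3)))) ∈ openConnIn (↑(box 3 m) : Set (Site 3)) x y) :
    ∃ A : Finset (Site 3), (box 3 n ⊆ A ∧ A ⊆ box 3 m \ innerBoundary (zdGraph 3) (box 3 m)) ∧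
      (edgeBoundary (zdGraph 3) A).filter (· ∈ ω) ⊆ S := by
  set A : Finset (Site 3) := (box 3 m).filter fun v => ∃ x ∈ box 3 n,
    (ω \ (↑S : Set (Sym2 (Site 3)))) ∈ openConnIn (↑(box 3 m) : Set (Site 3)) x v with hA
  have hnA : box 3 n ⊆ A := by
    intro x hx
    have hxm : x ∈ box 3 m := box_mono 3 hnm.le hx
    exact Finset.mem_filter.2
      ⟨hxm, x, hx, Finset.mem_coe.2 hxm, Finset.mem_coe.2 hxm, SimpleGraph.Reachable.refl _⟩
  have hAib : ∀ v ∈ A, v ∉ innerBoundary (zdGraph 3) (box 3 m) := by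
    intro v hv hvb
    obtain ⟨-, x, hx, hxv⟩ := Finset.mem_filter.1 hv
    exact hblk ⟨x, hx, v, hvb, hxv⟩
  refine ⟨A, ⟨hnA, fun v hv => Finset.mem_sdiff.2 ⟨(Finset.mem_filter.1 hv).1, hAib v hv⟩⟩, ?_⟩
  intro e he
  obtain ⟨heb, heω⟩ := Finset.mem_filter.1 he
  obtain ⟨heE, ⟨a, haA, hae⟩, ⟨b, hbA, hbe⟩⟩ := mem_edgeBoundary_iff.1 heb
  have hab : a ≠ b := fun h => hbA (h ▸ haA)
  obtain rfl : e = s(a, b) := (Sym2.mem_and_mem_iff hab).1 ⟨hae, hbe⟩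
  have hadj : (zdGraph 3).Adj a b := (SimpleGraph.mem_edgeSet _).1 heE
  obtain ⟨ham, x, hx, hxa⟩ := Finset.mem_filter.1 haA
  have hbm : b ∈ box 3 m := by
    by_contra hbm
    exact hAib a haA (mem_innerBoundary_iff.2 ⟨ham, b, hbm, hadj⟩)
  by_contra heS
  exact hbA (Finset.mem_filter.2 ⟨hbm, x, hx, openConnIn_step hxa hbm heω heS hab⟩)

end StubTightPocketExists

/-- **Existence of a tight pocket on the budget-(k+1) event** (line pocket-resampling-liveness-mass, stub 2).
For a lattice configuration `ω` in the budget-`(k+1)` blocked event of the window `box 3 n → ∂ⁱⁿ box 3 m`,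
`n < m`, there is an admissible set `A` (`box 3 n ⊆ A ⊆ box 3 m ∖ ∂ⁱⁿ box 3 m`) with at most `k+1`
`ω`-open boundary edges all of whose admissible proper subsets have at least `k+2`. -/
theorem stub_tightPocketExists :
    ∀ (k n m : ℕ) (ω : BondConfig (Site 3)), n < m → ω ⊆ (zdGraph 3).edgeSet →
      ω ∈ {ω : BondConfig (Site 3) | ∃ S : Finset (Sym2 (Site 3)), S.card ≤ k + 1 ∧ ¬ ∃ x ∈ box 3 n,
        ∃ y ∈ innerBoundary (zdGraph 3) (box 3 m), (ω \ (↑S : Set (Sym2 (Site 3)))) ∈ openConnIn (↑(box 3 m) : Set (Site 3)) x y} →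
      ∃ A : Finset (Site 3),
        (box 3 n ⊆ A ∧ A ⊆ box 3 m \ innerBoundary (zdGraph 3) (box 3 m)) ∧
        ((edgeBoundary (zdGraph 3) A).filter (· ∈ ω)).card ≤ k + 1 ∧
        ∀ A' : Finset (Site 3), (box 3 n ⊆ A' ∧ A' ⊆ box 3 m \ innerBoundary (zdGraph 3) (box 3 m)) →
          A' ⊂ A → k + 2 ≤ ((edgeBoundary (zdGraph 3) A').filter (· ∈ ω)).card := by
  intro k n m ω hnm _ hmem
  obtain ⟨S, hSk, hblk⟩ := hmem
  obtain ⟨A₀, hA₀adm, hA₀S⟩ := StubTightPocketExists.exists_admissible_filter_subset hnm S hblk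
  have hA₀k : ((edgeBoundary (zdGraph 3) A₀).filter (· ∈ ω)).card ≤ k + 1 :=
    (Finset.card_le_card hA₀S).trans hSk
  -- minimise the cardinality among the admissible sets with `≤ k+1` open boundary edges
  set C : Finset (Finset (Site 3)) := (box 3 m).powerset.filter fun A =>
    (box 3 n ⊆ A ∧ A ⊆ box 3 m \ innerBoundary (zdGraph 3) (box 3 m)) ∧
      ((edgeBoundary (zdGraph 3) A).filter (· ∈ ω)).card ≤ k + 1 with hC
  have hA₀C : A₀ ∈ C := Finset.mem_filter.2
    ⟨Finset.mem_powerset.2 (hA₀adm.2.trans Finset.sdiff_subset), hA₀adm, hA₀k⟩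
  obtain ⟨A, hAC, hmin⟩ := Finset.exists_min_image C Finset.card ⟨A₀, hA₀C⟩
  obtain ⟨-, hAadm, hAk⟩ := Finset.mem_filter.1 hAC
  refine ⟨A, hAadm, hAk, fun A' hA'adm hss => ?_⟩
  by_contra hlt
  have hA'C : A' ∈ C := Finset.mem_filter.2
    ⟨Finset.mem_powerset.2 (hA'adm.2.trans Finset.sdiff_subset), hA'adm, by omega⟩
  exact absurd (hmin A' hA'C) (not_le.2 (Finset.card_lt_card hss))

end Summit.CriticalPhenomena.PercolationContinuityZ3.Theorems
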